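import Mathlib
import HarnessLib
import Summits.HubbardSuperconductivity.HubbardSuperconductivity.Theorems.KLProgrammeKLRegimeTwoVolumeLipDoubledJumpRows
import Summits.HubbardSuperconductivity.HubbardSuperconductivity.Theorems.KLProgrammeKLRegimeTwoVolumeLipDoubledSourceTransfer

/-!
# Route `KLProgramme` — crux K3 ENGINE (stmt-HubbardSuperconductivity-20437), stub (e) proof-input «(e)-D-ROWS», keying (A′), REKEY-D file D6T-2:
# THE DOUBLED JUMP TRANSFER DOOR (free elements, any pair of scales `J′ ≥ J`), rows discharged
# (seat hubbard-kl-k3c4-p1 g28; the text of ✓ D3b-2/D3b′ `…TwoVolumeLipDoubledSourceTransfer(Generic)` with the block transfer `klLipTransferD … d k` replaced by the doubled jump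
#  `klJumpD … J′ J` and the two transferred elements FREE — the door each summand of the (Dμ)⁺ re-measurement of the truncated doubled tower goes through; `--supports` 23356)

* **`jumpD_transfer_le`** — the generic gluing door at `T⁺ = klJump ⊕ shift` (D6T-1 `klJumpD_periodise` + the six row data);
* **`jumpD_transfer_le_of_wtRows`** — the nine transfer data discharged from E1's two weighted sums of `klJump (bL) J′ J`, `1 ≤ cW`.

Composition of landed theorems (proofs = D3b's); nothing asserts the (D) rows, (e), VL, K3 or superconductivity.
References: BGM 2006 §2.7 (2.70)–(2.71), §2.9 (4.3)–(4.6) [cite: BenfattoGiulianiMastropietro2006]; Salmhofer 1998 §4.1.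
-/

noncomputable section

namespace Summit.HubbardSuperconductivity.HubbardSuperconductivity.Theorems.TwoVolumeLip

set_option linter.dupNamespace false -- summit = problem name (single-conjunct summit), D-0017

open Finset Literature.MathematicalPhysics.QuantumLattice GrassmannAlgebra Literature.Probability.LatticeModels
open Literature.MathematicalPhysics.QuantumLattice.FermiRG
open Summit.HubbardSuperconductivity.HubbardSuperconductivity.Theorems.KLRegimeSplit
open Summit.HubbardSuperconductivity.HubbardSuperconductivity.Theorems.KLProgrammeLegKernels
open Summit.HubbardSuperconductivity.HubbardSuperconductivity.Theorems.EngineV8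
open Summit.HubbardSuperconductivity.HubbardSuperconductivity.Theorems.TwoVolumeSource
open Summit.HubbardSuperconductivity.HubbardSuperconductivity.Theorems.TwoVolumeDefect

/-! ## §1 The doubled jump transfer door -/

section JumpDoorD

variable {L b M : ℕ} [NeZero L] [NeZero (b * L)] [NeZero M]

/-- **THE DOUBLED JUMP TRANSFER DOOR** (free elements `W′` on the fine doubled labels of scale `J`, `W` on the coarse ones; doubled jump `klJumpD … J′ J = klJump ⊕ shift`): the
generic gluing door ✓ `TwoVolumeDefect.sum_norm_kernel_map_sub_glue_map_le_of_defect` at `e₁ := klBlockEquivD … J`, `e₂ := klBlockEquivD … J′`, `Fe := klBlockEmbD`,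
`T := klJumpD L … J′ J`, `T′ := klJumpD (bL) … J′ J` (periodisation ✓ `klJumpD_periodise`).  Transfer data = the SECTOR data of `klJump (bL) J′ J` (`hcol hwin hρ hrowF hτF hτ₁ hτ₂ hτ₃ hτ₄`,
`1 ≤ a`) plus the plain-pin partner facts `hWF`, `hW₃`; kernel data `N, N_far` (profiles of `W`), `E, ND` (near / global profiles of the defect `W′ − klGlueD W`).  Output: the pinned
profile of `map T′⁺ W′ − klGlueD (map T⁺ W)` at `(p, w′)` is `≤ aⁿ(aE + τND) + (2aⁿτN + n·aⁿ(5τN + 2aN_far))` — the doubled twin of ✓ `…TwoVolumeLipJumpRows.klJump_transfer_le`.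
[cite: BenfattoGiulianiMastropietro2006, §2.7 (2.70)-(2.71), §2.9 (4.3)-(4.6)] -/
theorem jumpD_transfer_le {β : ℝ} (hβ : β ≠ 0) (μ : ℝ) (K : TrigPolyC4v) {J' J : ℕ}
    (W' : GrassmannAlgebra ℂ (SrcLabel (b * L) M J)) (W : GrassmannAlgebra ℂ (SrcLabel L M J)) {n : ℕ} (p : Fin (n + 1)) (w' : SrcLabel (b * L) M J')
    (Z Near : SpaceTimeIdx L M × SectorLeg (sectorCount J) → Prop) [DecidablePred Z] [DecidablePred Near]
    (Far : SpaceTimeIdx L M × SectorLeg (sectorCount J) → SpaceTimeIdx L M × SectorLeg (sectorCount J) → Prop)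
    [DecidableRel Far] (hZ : ∀ y y', Near y → Z y' → Far y y')
    (NearF : SpaceTimeIdx (b * L) M × SectorLeg (sectorCount J) → Prop) [DecidablePred NearF]
    {a τ N Nfar E ND : ℝ} (ha1 : 1 ≤ a) (hτ0 : 0 ≤ τ) (hN0 : 0 ≤ N) (hNfar0 : 0 ≤ Nfar) (hE0 : 0 ≤ E) (hND0 : 0 ≤ ND)
    (hcol : ∀ y', ∑ x, ‖klJump (b * L) M β μ K J' J x y'‖ ≤ a)
    (hwin : ∀ (B' : Fin 2 → Fin b) (y : SpaceTimeIdx L M × SectorLeg (sectorCount J)),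
      ∑ B : Fin 2 → Fin b, ∑ x ∈ univ.filter (fun x : SpaceTimeIdx (b * L) M × SectorLeg (sectorCount J') =>
          (klBlockEquiv L b M (sectorCount J') x).1 = B'),
        ‖klJump (b * L) M β μ K J' J x ((klBlockEquiv L b M (sectorCount J)).symm (B, y))‖ ≤ a)
    (hρ : w'.2 = 0 → ∑ y, ‖klJump (b * L) M β μ K J' J w'.1
        ((klBlockEquiv L b M (sectorCount J)).symm ((klBlockEquiv L b M (sectorCount J') w'.1).1, y))‖ ≤ a)
    (hrowF : ∑ y' ∈ univ.filter (fun y' : SpaceTimeIdx (b * L) M × SectorLeg (sectorCount J) => NearF y'),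
      ‖klJump (b * L) M β μ K J' J w'.1 y'‖ ≤ a)
    (hτF : ∑ y' ∈ univ.filter (fun y' : SpaceTimeIdx (b * L) M × SectorLeg (sectorCount J) => ¬ NearF y'),
      ‖klJump (b * L) M β μ K J' J w'.1 y'‖ ≤ τ)
    (hWF : w'.2 = 1 → ∀ y', klPlainShift (b * L) M (sectorCount J') (sectorCount J) w'.1 y' ≠ 0 → NearF y')
    (hτ₁ : ∀ y, ¬ Z y → ∑ x ∈ univ.filter (fun x : SpaceTimeIdx (b * L) M × SectorLeg (sectorCount J') =>
        (klBlockEquiv L b M (sectorCount J') x).1 ≠ (klBlockEquiv L b M (sectorCount J') w'.1).1),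
      ‖klJump (b * L) M β μ K J' J x
        ((klBlockEquiv L b M (sectorCount J)).symm ((klBlockEquiv L b M (sectorCount J') w'.1).1, y))‖ ≤ τ)
    (hτ₂ : w'.2 = 0 → ∑ B ∈ univ.erase (klBlockEquiv L b M (sectorCount J') w'.1).1, ∑ y,
      ‖klJump (b * L) M β μ K J' J w'.1 ((klBlockEquiv L b M (sectorCount J)).symm (B, y))‖ ≤ τ)
    (hτ₃ : w'.2 = 0 → ∑ y ∈ univ.filter (fun y : SpaceTimeIdx L M × SectorLeg (sectorCount J) => ¬ Near y),
      ‖klJump (b * L) M β μ K J' J w'.1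
        ((klBlockEquiv L b M (sectorCount J)).symm ((klBlockEquiv L b M (sectorCount J') w'.1).1, y))‖ ≤ τ)
    (hW₃ : w'.2 = 1 → ∀ y, klPlainShift (b * L) M (sectorCount J') (sectorCount J) w'.1
        ((klBlockEquiv L b M (sectorCount J)).symm ((klBlockEquiv L b M (sectorCount J') w'.1).1, y)) ≠ 0 → Near y)
    (hτ₄ : ∀ y, ¬ Z y → ∑ B ∈ univ.erase (klBlockEquiv L b M (sectorCount J') w'.1).1,
      ∑ x ∈ univ.filter (fun x : SpaceTimeIdx (b * L) M × SectorLeg (sectorCount J') =>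
          (klBlockEquiv L b M (sectorCount J') x).1 = (klBlockEquiv L b M (sectorCount J') w'.1).1),
        ‖klJump (b * L) M β μ K J' J x ((klBlockEquiv L b M (sectorCount J)).symm (B, y))‖ ≤ τ)
    (hN : ∀ y, ∑ Y ∈ univ.filter (fun Y : Fin (n + 1) → SrcLabel L M J => Y p = y),
      ‖kernel ℂ W (n + 1) Y‖ ≤ N)
    (hNfar : ∀ y (i : Fin (n + 1)),
      ∑ Y ∈ univ.filter (fun Y : Fin (n + 1) → SrcLabel L M J => Y p = y ∧ Far (Y p).1 (Y i).1),
        ‖kernel ℂ W (n + 1) Y‖ ≤ Nfar)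
    (hE : ∀ y', NearF y'.1 →
      ∑ Y' ∈ univ.filter (fun Y' : Fin (n + 1) → SrcLabel (b * L) M J => Y' p = y'),
        ‖kernel ℂ (W' -
            klGlueD L b M J
              W) (n + 1) Y'‖ ≤ E)
    (hND : ∀ y',
      ∑ Y' ∈ univ.filter (fun Y' : Fin (n + 1) → SrcLabel (b * L) M J => Y' p = y'),
        ‖kernel ℂ (W' -
            klGlueD L b M J
              W) (n + 1) Y'‖ ≤ ND) :
    ∑ X' ∈ univ.filter (fun X' : Fin (n + 1) → SrcLabel (b * L) M J' => X' p = w'),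
        ‖kernel ℂ (ExteriorAlgebra.map (Matrix.toLin' (klJumpD (b * L) M β μ K J' J))
              W' -
            klGlueD L b M J'
              (ExteriorAlgebra.map (Matrix.toLin' (klJumpD L M β μ K J' J)) W)) (n + 1) X'‖ ≤
      a ^ n * (a * E + τ * ND) + (2 * a ^ n * τ * N + n * a ^ n * (5 * τ * N + 2 * a * Nfar)) := by
  classical
  have ha : 0 ≤ a := le_trans zero_le_one ha1
  have hmain := sum_norm_kernel_map_sub_glue_map_le_of_defect (𝕜 := ℂ)
    (klBlockEquivD L b M J) (klBlockEquivD L b M J')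
    (klJumpD L M β μ K J' J) (klJumpD (b * L) M β μ K J' J) (fun X' Y => klJumpD_periodise hβ μ K J' J X' Y)
    (klBlockEmbD L b M J) (fun B v X' => klBlockEmbD_apply B v X')
    (klBlockEmbD L b M J') (fun B v X' => klBlockEmbD_apply B v X')
    W'
    W p w'
    (fun Y : SrcLabel L M J => Z Y.1) (fun Y : SrcLabel L M J => Near Y.1)
    (fun Y Y' : SrcLabel L M J => Far Y.1 Y'.1) (fun Y Y' hY hY' => hZ _ _ hY hY')
    (fun Y' : SrcLabel (b * L) M J => NearF Y'.1)
    ha hτ0 hN0 hNfar0 hE0 hND0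
    (colSum_doubleBlock_le _ _ _ (klJumpD_apply β μ K J' J) hcol (colSum_norm_klPlainShift_le_one (sectorCount_pos _)) ha1)
    (hwinJ_le μ K J' J ha1 hwin) (hrhoJ_le μ K J' J ha1 w' hρ)
    (by
      rcases Fin.exists_fin_two.1 ⟨w'.2, rfl⟩ with h | h
      · rw [rowSum_doubleBlock_filter_copy0 _ _ _ (klJumpD_apply β μ K J' J) NearF w' h]; exact hrowF
      · exact (rowSum_doubleBlock_filter_copy1_le _ _ _ (klJumpD_apply β μ K J' J)
          (fun x s => rowSum_norm_klPlainShift_le_one (sectorCount_pos _) x s) _ w' h).trans ha1)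
    (by
      have h10 : ¬ ((1 : Fin 2) = 0) := by decide
      rcases Fin.exists_fin_two.1 ⟨w'.2, rfl⟩ with h | h
      · rw [rowSum_doubleBlock_filter_copy0 _ _ _ (klJumpD_apply β μ K J' J) (fun y => ¬ NearF y) w' h]; exact hτF
      · refine le_trans (le_of_eq (Finset.sum_eq_zero fun y' hy' => ?_)) hτ0
        rw [Finset.mem_filter] at hy'
        rw [klJumpD_apply, h]
        simp only [h10, false_and, if_false, true_and]
        by_cases hy2 : y'.2 = 1
        · rw [if_pos hy2, norm_eq_zero]
          by_contra hne
          exact hy'.2 (hWF h y'.1 hne)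
        · rw [if_neg hy2, norm_zero])
    (htau1J_le μ K J' J hτ0 w' Z hτ₁) (htau2J_le μ K J' J hτ0 w' hτ₂) (htau3J_le μ K J' J hτ0 w' Near hτ₃ hW₃) (htau4J_le μ K J' J hτ0 w' Z hτ₄)
    hN (fun Y i => hNfar Y i) (fun Y' hY' => hE Y' hY') hND
  refine Eq.trans_le (Finset.sum_congr rfl fun X' _ => ?_) hmain
  rw [kernel_sub', klGlueD_def (ExteriorAlgebra.map (Matrix.toLin' (klJumpD L M β μ K J' J))
    W)]

end JumpDoorD

/-! ## §2 Rows discharged from E1's two weighted jump sums -/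

section JumpDoorDRows

variable {L b M : ℕ} [NeZero L] [NeZero (b * L)] [NeZero M]

omit [NeZero L] [NeZero (b * L)] [NeZero M] in
/-- The torus sup-norm of the zero site vanishes (local one-liner). [folklore] -/
private theorem tnorm_zero_locDJ {dd V : ℕ} [NeZero V] : Torus.tnorm (0 : TorusSite dd V) = 0 := by
  have h : Torus.tnorm (0 : TorusSite dd V) ≤ Site.supNorm (0 : Site dd) := by
    have h1 := Torus.tnorm_proj_le (L := V) (0 : Site dd)
    have h0 : Torus.proj V (0 : Site dd) = 0 := by
      funext i
      simp [Torus.proj_apply]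
    rwa [h0] at h1
  have h2 : Site.supNorm (0 : Site dd) = 0 := Nat.le_zero.1 (Site.supNorm_le_iff.2 fun i => by simp)
  exact Nat.le_zero.1 (h2 ▸ h)

set_option maxHeartbeats 400000 in -- the nine transfer data and the door in one declaration
/-- **THE DOUBLED JUMP TRANSFER DOOR, ROWS DISCHARGED** (doubled twin of ✓ `…TwoVolumeLipJumpRows.klJump_transfer_le_of_scaleWtRows`): from the two `(1 + Λ_T·tnorm)`-weighted
row / column sums `cW` (`1 ≤ cW`) of `klJump (bL) J′ J` (periodisation ✓ `klJump_periodise`, block covariance ✓ `norm_klJump_blockCovariant`), at a `(D₀ + r)`-deep pin `w′` of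
EITHER copy (`2r ≤ D₀`), the pinned profile of `map (klJumpD (bL)) W′ − klGlueD (map (klJumpD L) W)` is `≤ cWⁿ(cW·E + τ·ND) + (2cWⁿτN + n·cWⁿ(5τN + 2cW·N_far))`,
`τ = cW/(1 + Λ_T(r+1))`, with `N, N_far` the plain / `r`-far pinned profiles of `W` and `E, ND` the near / global profiles of the defect `W′ − klGlueD W`; plain-pin partner facts
discharged (same site, `tnorm 0 ≤ r`). -/
theorem jumpD_transfer_le_of_wtRows {β : ℝ} (hβ : 0 < β) (μ : ℝ) (K : TrigPolyC4v) {J' J : ℕ}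
    (W' : GrassmannAlgebra ℂ (SrcLabel (b * L) M J)) (W : GrassmannAlgebra ℂ (SrcLabel L M J))
    {ΛT cW : ℝ} (hΛT : 0 ≤ ΛT) (hcW1 : 1 ≤ cW)
    (hrow : ∀ x : SpaceTimeIdx (b * L) M × SectorLeg (sectorCount J'), ∑ y', ‖klJump (b * L) M β μ K J' J x y'‖ *
      (1 + ΛT * (Torus.tnorm (x.1.2 - y'.1.2) : ℝ)) ≤ cW)
    (hcol : ∀ y' : SpaceTimeIdx (b * L) M × SectorLeg (sectorCount J), ∑ x, ‖klJump (b * L) M β μ K J' J x y'‖ *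
      (1 + ΛT * (Torus.tnorm (x.1.2 - y'.1.2) : ℝ)) ≤ cW)
    {n : ℕ} (p : Fin (n + 1)) (w' : SrcLabel (b * L) M J') (D₀ r : ℕ) (hD₀ : 2 * r ≤ D₀)
    (hw : ∀ i, D₀ + r ≤ (w'.1.1.2 i).val % L ∧ (w'.1.1.2 i).val % L + (D₀ + r) < L)
    {N Nfar E ND : ℝ} (hN0 : 0 ≤ N) (hNfar0 : 0 ≤ Nfar) (hE0 : 0 ≤ E) (hND0 : 0 ≤ ND)
    (hN : ∀ y, ∑ Y ∈ univ.filter (fun Y : Fin (n + 1) → SrcLabel L M J => Y p = y),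
      ‖kernel ℂ W (n + 1) Y‖ ≤ N)
    (hNfar : ∀ y (i : Fin (n + 1)),
      ∑ Y ∈ univ.filter (fun Y : Fin (n + 1) → SrcLabel L M J => Y p = y ∧ r < Torus.tnorm ((Y p).1.1.2 - (Y i).1.1.2)),
        ‖kernel ℂ W (n + 1) Y‖ ≤ Nfar)
    (hE : ∀ y' : SrcLabel (b * L) M J, Torus.tnorm (w'.1.1.2 - y'.1.1.2) ≤ r →
      ∑ Y' ∈ univ.filter (fun Y' : Fin (n + 1) → SrcLabel (b * L) M J => Y' p = y'),
        ‖kernel ℂ (W' -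
            klGlueD L b M J
              W) (n + 1) Y'‖ ≤ E)
    (hND : ∀ y',
      ∑ Y' ∈ univ.filter (fun Y' : Fin (n + 1) → SrcLabel (b * L) M J => Y' p = y'),
        ‖kernel ℂ (W' -
            klGlueD L b M J
              W) (n + 1) Y'‖ ≤ ND) :
    ∑ X' ∈ univ.filter (fun X' : Fin (n + 1) → SrcLabel (b * L) M J' => X' p = w'),
        ‖kernel ℂ (ExteriorAlgebra.map (Matrix.toLin' (klJumpD (b * L) M β μ K J' J))
              W' -
            klGlueD L b M J'
              (ExteriorAlgebra.map (Matrix.toLin' (klJumpD L M β μ K J' J)) W)) (n + 1) X'‖ ≤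
      cW ^ n * (cW * E + cW / (1 + ΛT * ((r : ℝ) + 1)) * ND) +
        (2 * cW ^ n * (cW / (1 + ΛT * ((r : ℝ) + 1))) * N + n * cW ^ n * (5 * (cW / (1 + ΛT * ((r : ℝ) + 1))) * N + 2 * cW * Nfar)) := by
  classical
  haveI : NeZero b := ⟨fun h => NeZero.ne (b * L) (by rw [h, zero_mul])⟩
  have hβ0 : β ≠ 0 := hβ.ne'
  have hcW : 0 ≤ cW := le_trans zero_le_one hcW1
  set T' := klJump (b * L) M β μ K J' J with hT'
  set ed := klBlockEquiv L b M (sectorCount J') with hed_def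
  set ed₁ := klBlockEquiv L b M (sectorCount J) with hed₁_def
  have hed1 : ∀ (x : SpaceTimeIdx (b * L) M × SectorLeg (sectorCount J')) i, ((ed x).1 i : ℕ) = (x.1.2 i).val / L :=
    fun x i => klBlockEquiv_val L b M _ x i
  have hed₁1 : ∀ (y' : SpaceTimeIdx (b * L) M × SectorLeg (sectorCount J)) i, ((ed₁ y').1 i : ℕ) = (y'.1.2 i).val / L :=
    fun y' i => klBlockEquiv_val L b M _ y' i
  have hed2s : ∀ x : SpaceTimeIdx (b * L) M × SectorLeg (sectorCount J'),
      (fun Y : SpaceTimeIdx L M × SectorLeg (sectorCount J') => Y.1.2) (ed x).2 = fun i => ((((x.1.2 i).val : ℕ)) : ZMod L) := fun x => by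
    dsimp only; rw [hed_def, klBlockEquiv_snd]
  have hed₁2s : ∀ y' : SpaceTimeIdx (b * L) M × SectorLeg (sectorCount J),
      (fun Y : SpaceTimeIdx L M × SectorLeg (sectorCount J) => Y.1.2) (ed₁ y').2 = fun i => ((((y'.1.2 i).val : ℕ)) : ZMod L) := fun y' => by
    dsimp only; rw [hed₁_def, klBlockEquiv_snd]
  have hcov : ∀ (δ B' B : Fin 2 → Fin b) (xbar : SpaceTimeIdx L M × SectorLeg (sectorCount J')) (y : SpaceTimeIdx L M × SectorLeg (sectorCount J)),
      ‖T' (ed.symm (B' + δ, xbar)) (ed₁.symm (B + δ, y))‖ = ‖T' (ed.symm (B', xbar)) (ed₁.symm (B, y))‖ :=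
    fun δ B' B xbar y => norm_klJump_blockCovariant hβ0 μ K J' J δ B' B xbar y
  have hτT : 0 ≤ cW / (1 + ΛT * ((r : ℝ) + 1)) := by positivity
  have hTcol := transfer_col_le (fun x : SpaceTimeIdx (b * L) M × SectorLeg (sectorCount J') => x.1.2)
    (fun y' : SpaceTimeIdx (b * L) M × SectorLeg (sectorCount J) => y'.1.2) T' hΛT hcol
  have hTwin := transfer_win_le (fun x : SpaceTimeIdx (b * L) M × SectorLeg (sectorCount J') => x.1.2)
    (fun y' : SpaceTimeIdx (b * L) M × SectorLeg (sectorCount J) => y'.1.2) T' hΛT hcol ed ed₁ hcov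
  have hTρ := transfer_rho_le (fun x : SpaceTimeIdx (b * L) M × SectorLeg (sectorCount J') => x.1.2)
    (fun y' : SpaceTimeIdx (b * L) M × SectorLeg (sectorCount J) => y'.1.2) T' hΛT hrow ed ed₁
  have hTrowF := transfer_rowF_le (fun x : SpaceTimeIdx (b * L) M × SectorLeg (sectorCount J') => x.1.2)
    (fun y' : SpaceTimeIdx (b * L) M × SectorLeg (sectorCount J) => y'.1.2) T' hΛT hrow r
  have hTτF := transfer_tauF_le (fun x : SpaceTimeIdx (b * L) M × SectorLeg (sectorCount J') => x.1.2)
    (fun y' : SpaceTimeIdx (b * L) M × SectorLeg (sectorCount J) => y'.1.2) T' hΛT hrow hcW (le_refl r)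
  have hTτ2 := transfer_tau2_le (fun x : SpaceTimeIdx (b * L) M × SectorLeg (sectorCount J') => x.1.2)
    (fun y' : SpaceTimeIdx (b * L) M × SectorLeg (sectorCount J) => y'.1.2) T' hΛT hrow hcW (rfl : b * L = b * L) ed ed₁ hed1 hed₁1
    (Nat.le_add_left r D₀) w'.1 hw
  have hTτ3 := transfer_tau3_le (fun x : SpaceTimeIdx (b * L) M × SectorLeg (sectorCount J') => x.1.2)
    (fun y' : SpaceTimeIdx (b * L) M × SectorLeg (sectorCount J) => y'.1.2) T' hΛT hrow hcW (rfl : b * L = b * L) ed ed₁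
    (fun Y : SpaceTimeIdx L M × SectorLeg (sectorCount J') => Y.1.2) (fun Y : SpaceTimeIdx L M × SectorLeg (sectorCount J) => Y.1.2)
    hed2s hed₁2s (le_refl r) w'.1
  have hTτ1 := transfer_tau1_le (fun x : SpaceTimeIdx (b * L) M × SectorLeg (sectorCount J') => x.1.2)
    (fun y' : SpaceTimeIdx (b * L) M × SectorLeg (sectorCount J) => y'.1.2) T' hΛT hcol (rfl : b * L = b * L) ed ed₁ hed1 hed₁1
    (fun Y : SpaceTimeIdx L M × SectorLeg (sectorCount J') => Y.1.2) (fun Y : SpaceTimeIdx L M × SectorLeg (sectorCount J) => Y.1.2)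
    hed2s hed₁2s (RZ := 2 * r) (by omega : r + 2 * r ≤ D₀ + r) w'.1 hw
  have hTτ4 := transfer_tau4_le (fun x : SpaceTimeIdx (b * L) M × SectorLeg (sectorCount J') => x.1.2)
    (fun y' : SpaceTimeIdx (b * L) M × SectorLeg (sectorCount J) => y'.1.2) T' hΛT hcol (rfl : b * L = b * L) ed ed₁ hed1 hed₁1
    (fun Y : SpaceTimeIdx L M × SectorLeg (sectorCount J') => Y.1.2) (fun Y : SpaceTimeIdx L M × SectorLeg (sectorCount J) => Y.1.2)
    hed2s hed₁2s hcov (RZ := 2 * r) (by omega : r + 2 * r ≤ D₀ + r) w'.1 hw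
  have hZT : ∀ y y' : SpaceTimeIdx L M × SectorLeg (sectorCount J), Torus.tnorm ((ed w'.1).2.1.2 - y.1.2) ≤ r →
      2 * r < Torus.tnorm ((ed w'.1).2.1.2 - y'.1.2) → r < Torus.tnorm (y.1.2 - y'.1.2) := by
    intro y y' hy hy'
    have htri := Torus.tnorm_add_le ((ed w'.1).2.1.2 - y.1.2) (y.1.2 - y'.1.2)
    rw [sub_add_sub_cancel] at htri; omega
  -- the plain-pin partner facts: the shift's partner sits at the SAME site
  have hWF : w'.2 = 1 → ∀ y', klPlainShift (b * L) M (sectorCount J') (sectorCount J) w'.1 y' ≠ 0 → Torus.tnorm (w'.1.1.2 - y'.1.2) ≤ r := by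
    intro _ y' hne
    rw [klPlainShift_ne_zero_site hne, sub_self, tnorm_zero_locDJ]; exact Nat.zero_le _
  have hW₃ : w'.2 = 1 → ∀ y, klPlainShift (b * L) M (sectorCount J') (sectorCount J) w'.1 (ed₁.symm ((ed w'.1).1, y)) ≠ 0 →
      Torus.tnorm ((ed w'.1).2.1.2 - y.1.2) ≤ r := by
    intro _ y hne
    have hs := klPlainShift_ne_zero_site hne
    have h2 : (ed w'.1).2.1.2 = y.1.2 := by
      have hy : (ed₁ (ed₁.symm ((ed w'.1).1, y))).2 = y := by rw [Equiv.apply_symm_apply]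
      rw [hed₁_def, klBlockEquiv_snd, ← hs] at hy
      rw [hed_def, klBlockEquiv_snd, ← hy]
    rw [h2, sub_self, tnorm_zero_locDJ]; exact Nat.zero_le _
  exact jumpD_transfer_le hβ0 μ K W' W p w' (fun y => 2 * r < Torus.tnorm ((ed w'.1).2.1.2 - y.1.2))
    (fun y => Torus.tnorm ((ed w'.1).2.1.2 - y.1.2) ≤ r) (fun y y' => r < Torus.tnorm (y.1.2 - y'.1.2)) hZT
    (fun y' => Torus.tnorm (w'.1.1.2 - y'.1.2) ≤ r) hcW1 hτT hN0 hNfar0 hE0 hND0 hTcol hTwin (fun _ => hTρ w'.1) (hTrowF w'.1) (hTτF w'.1) hWF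
    (fun y hy => hTτ1 y hy) (fun _ => hTτ2) (fun _ => hTτ3) hW₃ (fun y hy => hTτ4 y hy) hN hNfar hE hND

end JumpDoorDRows

end Summit.HubbardSuperconductivity.HubbardSuperconductivity.Theorems.TwoVolumeLip

end
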